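import Literature.Topology.FourManifolds.IsotopyProofs
import Literature.Topology.FourManifolds.WhitneyModelTransport
import HarnessLib

/-!
# Composing finitely many ambient isotopies with pairwise disjoint supports

Topic `Literature/Topology/FourManifolds`.  Hirsch, *Differential Topology* (1976), Ch. 8 §1,
p. 179: isotopies with disjoint (compact) supports are composed at will, the composite being
each of them on its own support.  For the tree's `AmbientIsotopy` (`Isotopy.lean`) and its
stagewise composition `AmbientIsotopy.comp` (`IsotopyProofs.lean`):

* `AmbientIsotopy.exists_forall_eqOn_of_pairwise_disjoint` — given finitely many ambient
  isotopies `Ψ i` of `N` and pairwise disjoint sets `O i` such that `Ψ i` is the identity off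
  `O i` at all times, there is an ambient isotopy `Φ` of `N` which on `O i` is `Ψ i` (all
  times) and is the identity off `⋃ O i`; moreover every `O i` is mapped into itself.

Everything here is proved; no named facts.

## References

* M. W. Hirsch, *Differential Topology*, GTM 33 (1976), Ch. 8 §1, pp. 178–179. [HirschDT1976]
-/

open Set Function

noncomputable section

namespace Literature.Topology.FourManifolds

namespace AmbientIsotopy

variable {EN : Type*} [NormedAddCommGroup EN] [NormedSpace ℝ EN] {HN : Type*} [TopologicalSpace HN]
  {J : ModelWithCorners ℝ EN HN} {N : Type*} [TopologicalSpace N] [ChartedSpace HN N]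
  {ι : Type*}

/-- A bijective stage which is the identity off `O` maps `O` into itself. [folklore] -/
theorem mapsTo_of_eq_self_off_stage (Ψ : AmbientIsotopy J N) {O : Set N} (h : ∀ t y, y ∉ O → Ψ.toFun t y = y)
    (t : ℝ) : MapsTo (Ψ.toFun t) O O :=
  mapsTo_of_eq_self_off (Ψ.bijective t).1 (h t) Subset.rfl

/-- The composite along a list of indices: `foldComp Ψ [i₁, …, i_k]` has stages
`Ψ_{i_k, t} ∘ ⋯ ∘ Ψ_{i₁, t}`. [folklore] -/
def foldComp (Ψ : ι → AmbientIsotopy J N) : List ι → AmbientIsotopy J N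
  | [] => AmbientIsotopy.refl
  | i :: L => (Ψ i).comp (foldComp Ψ L)

/-- `foldComp_nil`. [folklore] -/
@[simp] theorem foldComp_nil (Ψ : ι → AmbientIsotopy J N) : foldComp Ψ [] = AmbientIsotopy.refl := rfl

/-- `foldComp_cons_toFun`. [folklore] -/
theorem foldComp_cons_toFun (Ψ : ι → AmbientIsotopy J N) (i : ι) (L : List ι) (t : ℝ) (y : N) :
    (foldComp Ψ (i :: L)).toFun t y = (foldComp Ψ L).toFun t ((Ψ i).toFun t y) := rfl

/-- **The composite along a list of indices with pairwise disjoint supports**: on `O i`, `i` in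
the list, it is `Ψ i`; off the supports of the listed isotopies it is the identity. [cite: HirschDT1976, Ch. 8 §1, p. 179] -/
theorem foldComp_spec (Ψ : ι → AmbientIsotopy J N) (O : ι → Set N) (hdisj : Pairwise (Disjoint on O))
    (hsupp : ∀ i t y, y ∉ O i → (Ψ i).toFun t y = y) :
    ∀ L : List ι, L.Nodup →
      (∀ i ∈ L, ∀ t, ∀ y ∈ O i, (foldComp Ψ L).toFun t y = (Ψ i).toFun t y) ∧
      (∀ t y, (∀ i ∈ L, y ∉ O i) → (foldComp Ψ L).toFun t y = y)
  | [], _ => ⟨fun i hi => by simp at hi, fun t y _ => rfl⟩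
  | j :: L, hnd => by
    rw [List.nodup_cons] at hnd
    obtain ⟨hjL, hL⟩ := hnd
    obtain ⟨ih1, ih2⟩ := foldComp_spec Ψ O hdisj hsupp L hL
    refine ⟨fun i hi t y hy => ?_, fun t y hy => ?_⟩
    · rw [foldComp_cons_toFun]
      rcases List.mem_cons.1 hi with rfl | hiL
      · -- `y ∈ O j`: `Ψ j` moves it inside `O j`, the rest fixes it
        have hy' : (Ψ i).toFun t y ∈ O i := mapsTo_of_eq_self_off_stage (Ψ i) (hsupp i) t hy
        exact ih2 t _ fun i' hi' hmem => by
          have hne : i ≠ i' := fun h => hjL (h ▸ hi')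
          exact Set.disjoint_left.1 (hdisj hne) hy' hmem
      · -- `y ∈ O i`, `i ≠ j`: `Ψ j` fixes it, the rest is `Ψ i`
        have hne : j ≠ i := fun h => hjL (h ▸ hiL)
        have hyj : y ∉ O j := fun h => Set.disjoint_left.1 (hdisj hne) h hy
        rw [hsupp j t y hyj]
        exact ih1 i hiL t y hy
    · rw [foldComp_cons_toFun, hsupp j t y (hy j (List.mem_cons_self)), ih2 t y fun i hi => hy i (List.mem_cons_of_mem j hi)]

/-- **Composing finitely many ambient isotopies with pairwise disjoint supports.**  Given
ambient isotopies `Ψ i`, `i` in a finite type, and pairwise disjoint sets `O i` with `Ψ i = id`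
off `O i` at all times, there is an ambient isotopy `Φ` which is `Ψ i` on `O i` (all times), is
the identity off `⋃ O i`, and maps every `O i` into itself. [cite: HirschDT1976, Ch. 8 §1, p. 179] -/
theorem exists_forall_eqOn_of_pairwise_disjoint [Finite ι] (Ψ : ι → AmbientIsotopy J N) (O : ι → Set N)
    (hdisj : Pairwise (Disjoint on O)) (hsupp : ∀ i t y, y ∉ O i → (Ψ i).toFun t y = y) :
    ∃ Φ : AmbientIsotopy J N, (∀ i t, ∀ y ∈ O i, Φ.toFun t y = (Ψ i).toFun t y) ∧
      (∀ t y, (∀ i, y ∉ O i) → Φ.toFun t y = y) ∧ (∀ i t, MapsTo (Φ.toFun t) (O i) (O i)) := by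
  classical
  haveI := Fintype.ofFinite ι
  set L : List ι := Finset.univ.toList with hL
  have hnd : L.Nodup := Finset.nodup_toList _
  have hmem : ∀ i, i ∈ L := fun i => by rw [hL, Finset.mem_toList]; exact Finset.mem_univ i
  obtain ⟨h1, h2⟩ := foldComp_spec Ψ O hdisj hsupp L hnd
  refine ⟨foldComp Ψ L, fun i t y hy => h1 i (hmem i) t y hy, fun t y hy => h2 t y fun i _ => hy i, fun i t y hy => ?_⟩
  rw [h1 i (hmem i) t y hy]
  exact mapsTo_of_eq_self_off_stage (Ψ i) (hsupp i) t hy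

end AmbientIsotopy

end Literature.Topology.FourManifolds
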